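import Literature.NumberTheory.Sieve.Maynard2016Prop5Equivalence
import Literature.NumberTheory.LFunctions.PrimeNumberTheoremErrorTermProofs
import HarnessLib

/-!
# Maynard 2016: the remaining inputs of Theorem 1 (Lemma 2, Lemma 3, the GPY measures)

Topic `Literature/NumberTheory/Sieve`. Bookkeeping corollaries: the prime number theorem with
de la Vallée Poussin's error term is PROVED in the tree
(`Literature.NumberTheory.LFunctions.ChebyshevThetaDeLaValleePoussin_holds`,
`PrimeNumberTheoremErrorTermProofs.lean`), so the hypothesis `ChebyshevThetaDeLaValleePoussin` of
`proposition5_of_prime` / `theorem1_of_GPYMeasures` (`Maynard2016Prop5Equivalence.lean`) is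
discharged. What remains assumed, as named facts of J. Maynard, *Large gaps between primes*,
Ann. of Math. 183 (2016), is exactly:

* `Lemma2` (Maier–Pomerance: shifted smooth numbers, `|𝓡′| ≪ x/(log x)^{1+ε}`),
* `Lemma3` (fundamental lemma + Bombieri–Vinogradov count of `{z < p ≤ V : (mp − 1, P_y) = 1}`),
* `GPYMeasures` (§4 ¶1, delivered by the multidimensional sieve of §§5–8).

PROVED around them (this series of files): Lemma 3 ⇒ Lemma 4; §3 (probabilistic method,
GPY measures ⇒ Proposition 5′, Proposition 5′ ⇒ Proposition 5); §2 (Lemmas 2, 4, Proposition 5 ⇒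
the covering statement ⇒ Theorem 1 ⇒ Rankin's bound with every constant).

## References

* J. Maynard, *Large gaps between primes*, Ann. of Math. (2) 183 (2016), 915–933; arXiv:1408.5110.
  [Maynard2016LargeGaps]
-/

namespace Literature.NumberTheory.Sieve

namespace Maynard2016

/-- **Proposition 5′ ⇒ Proposition 5** with the prime number theorem input discharged
(`ChebyshevThetaDeLaValleePoussin_holds`). [cite: Maynard2016LargeGaps, §3 (first paragraph)] -/
theorem proposition5_of_proposition5Prime (h5 : Proposition5Prime) (h3 : Lemma3) :
    Literature.NumberTheory.Sieve.Maynard2016.Proposition5 :=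
  proposition5_of_prime h5 h3 Literature.NumberTheory.LFunctions.ChebyshevThetaDeLaValleePoussin_holds

/-- **Maynard 2016, Theorem 1 from Lemma 2, Lemma 3 and the GPY measures of §4** (everything
else — §2, §3 and the prime number theorem with error term — PROVED in the tree).
[cite: Maynard2016LargeGaps, Thm 1] -/
theorem theorem1_of_GPY (h₂ : Lemma2) (h₃ : Lemma3) (hμ : GPYMeasures) :
    Literature.NumberTheory.Sieve.Maynard2016_theorem1 :=
  theorem1_of_GPYMeasures h₂ h₃ hμ
    Literature.NumberTheory.LFunctions.ChebyshevThetaDeLaValleePoussin_holds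

/-- … hence Rankin's bound `G(X) ≥ c log X log₂ X log₄ X/(log₃ X)²` with an arbitrary constant `c`,
from Lemma 2, Lemma 3 and the GPY measures. [cite: Maynard2016LargeGaps, Thm 1] -/
theorem forall_rankinConstant_of_GPY (h₂ : Lemma2) (h₃ : Lemma3) (hμ : GPYMeasures) (c : ℝ) :
    Literature.NumberTheory.Sieve.RankinConstant c :=
  forall_rankinConstant_of_GPYMeasures h₂ h₃ hμ
    Literature.NumberTheory.LFunctions.ChebyshevThetaDeLaValleePoussin_holds c

end Maynard2016

end Literature.NumberTheory.Sieve
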